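import Summits.ValiantsHypothesis.ValiantsHypothesis.Theorems.DivisionGapPerDivisionHardPerPowersCount
import Summits.ValiantsHypothesis.ValiantsHypothesis.Theorems.DivisionGapPerDivisionHardStubSparseRigidCount

/-!
# Crux `DivisionGap.PerDivisionHard` (stmt-ValiantsHypothesis-5065), line `pair-descent-jss-endpoint` —
the POWERS rung: `2^{⌊n/3⌋} ≤ L₊(per_n^M)` for every `M ≥ 1`; the crux on the cofactors `per_n^M`

The crux asks `2^{(log₂ n + c)^c} < L₊(per_n · h) + L₊(h)` for every nonzero cofactor `h`
(`complexity` = fan-in-two circuit size over the semiring `ℝ≥0`).  On the family `h = per_n^M` —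
where the support and transparency methods give only `n^{Ω(log n)}` (Boolean transfer) — the pair
is exponentially expensive, uniformly in `M`, because every power of the permanent is:

* `perPow_complexity_lower` — `2^{⌊n/3⌋} ≤ L₊(per_n^M)` for `n ≥ 6`, `M ≥ 1`: all `n!` pure
  monomials `M • μ_π` occur in `per_n^M` (`smul_permMonomial_mem_support_perPow`), every monomial
  of `per_n^M` has all row and column sums `M` (`margins_perPow`), and a size-`s` monotone circuit
  for such a polynomial exhibits at most `s · n!/2^{⌊n/3⌋}` pure monomials (the typed vertex count
  `card_pure_mul_two_pow_le` of `…PerPowersCount.lean`; idea card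
  `Cruxes/PerDivisionHard/Ideas/typed-vertex-rectangles.md`, after [JerrumSnir1982, §4.3]).
* `perDivisionHard_powers` — the crux on `h = per_n^M`, all `M`: `per · per^M = per^{M+1}` alone
  costs `≥ 2^{⌊n/3⌋} > 2^{(log₂ n + c)^c}` once `3 (log₂ n + c)^c + 3 ≤ n` (`three_mul_polylog_le`).
-/

noncomputable section

-- `Summit.ValiantsHypothesis.ValiantsHypothesis.…` is the tree's mandated single-conjunct layout
-- (Sub = Summit), so the duplicated namespace component is intended.
set_option linter.dupNamespace false

namespace Summit.ValiantsHypothesis.ValiantsHypothesis.Theorems.DivisionGapPerDivisionHard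

open MvPolynomial Literature.Computability.AlgebraicComplexity
open Literature.Computability.AlgebraicComplexity.ArithCircuit
open Literature.Barriers.ValiantsHypothesis
open scoped NNReal Pointwise

variable {n : ℕ}

/-! ### Powers of the permanent -/

/-- Every monomial of `per_n^M` has all row sums and all column sums equal to `M`
(`supp (per · F) ⊆ supp per + supp F` and permutation monomials have unit margins). [folklore] -/
theorem margins_perPow (M : ℕ) : ∀ α ∈ ((perPoly (Fin n) ℝ≥0) ^ M).support,
    (∀ i, ∑ j, α (i, j) = M) ∧ (∀ j, ∑ i, α (i, j) = M) := by
  classical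
  induction M with
  | zero =>
    intro α hα
    rw [pow_zero, support_one, Finset.mem_singleton] at hα
    subst hα
    simp
  | succ M ih =>
    intro α hα
    rw [pow_succ'] at hα
    obtain ⟨u, hu, β, hβ, rfl⟩ := Finset.mem_add.mp (support_mul _ _ hα)
    obtain ⟨σ, rfl⟩ := exists_permMonomial_eq_of_coeff_perPoly_ne_zero ℝ≥0 (mem_support_iff.mp hu)
    obtain ⟨hr, hc⟩ := ih β hβ
    refine ⟨fun i => ?_, fun j => ?_⟩
    · have h1 : ∑ j, permMonomial σ (i, j) = 1 := rowCount_permMonomial σ i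
      simp only [Finsupp.coe_add, Pi.add_apply, Finset.sum_add_distrib, h1, hr i]
      omega
    · have h1 : ∑ i, permMonomial σ (i, j) = 1 := colCount_permMonomial σ j
      simp only [Finsupp.coe_add, Pi.add_apply, Finset.sum_add_distrib, h1, hc j]
      omega

/-- The pure monomials `M • μ_π` occur in `per_n^M` (the term `ρ₁ = ⋯ = ρ_M = π` of the
expansion; over `ℝ≥0` nothing cancels). [folklore] -/
theorem smul_permMonomial_mem_support_perPow (M : ℕ) (π : Equiv.Perm (Fin n)) :
    M • permMonomial π ∈ ((perPoly (Fin n) ℝ≥0) ^ M).support := by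
  classical
  induction M with
  | zero =>
    rw [pow_zero, support_one, zero_smul]
    exact Finset.mem_singleton_self 0
  | succ M ih =>
    rw [pow_succ', succ_nsmul']
    refine Literature.Barriers.ValiantsHypothesis.add_mem_support_mul ?_ ih
    rw [mem_support_iff, coeff_permMonomial_perPoly]
    exact one_ne_zero

/-- **The powers of the permanent are exponentially hard for monotone circuits, uniformly in the
exponent:** `2^{⌊n/3⌋} ≤ L₊(per_n^M)` for all `n ≥ 6`, `M ≥ 1` (typed vertex count: all `n!` pure
monomials `M • μ_π` occur in `per_n^M`, and a size-`s` circuit covers at most `s · n!/2^{⌊n/3⌋}` of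
them, `card_pure_mul_two_pow_le`).  Idea card
`Cruxes/PerDivisionHard/Ideas/typed-vertex-rectangles.md` (planner-cruxidea-…-5065-2);
the `M = 1` case is Jerrum–Snir's bound by support [cite: JerrumSnir1982, §4.3]. -/
theorem perPow_complexity_lower :
    ∀ n M : ℕ, 6 ≤ n → 1 ≤ M → 2 ^ (n / 3) ≤ complexity (perPoly (Fin n) ℝ≥0 ^ M) := by
  intro n M hn hM
  classical
  obtain ⟨P, h2, hP, hsize⟩ := exists_computes_size_eq_complexity (perPoly (Fin n) ℝ≥0 ^ M)
  have heval : P.eval = perPoly (Fin n) ℝ≥0 ^ M := hP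
  have hZ : ∃ Z : Finset ℕ, Z.card ≤ P.size ∧ ∀ j ∉ Z, (gateValues P.gates).getD j 0 = 0 := by
    refine ⟨Finset.range P.size, by simp, fun j hj => getD_gateValues_eq_zero ?_⟩
    exact List.getElem?_eq_none_iff.mpr (by simpa [ArithCircuit.size] using hj)
  have hcount := card_pure_mul_two_pow_le n M P.size P (by omega) hM h2 hZ
    (by rw [heval]; exact margins_perPow M)
  have hall : (Finset.univ.filter fun π : Equiv.Perm (Fin n) =>
      M • permMonomial π ∈ P.eval.support) = Finset.univ :=
    Finset.filter_true_of_mem fun π _ => by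
      rw [heval]; exact smul_permMonomial_mem_support_perPow M π
  rw [hall, Finset.card_univ, Fintype.card_perm, Fintype.card_fin, mul_comm, hsize] at hcount
  exact Nat.le_of_mul_le_mul_right hcount (Nat.factorial_pos n)

/-! ### The rung: the crux on the cofactors `per_n^M` -/

/-- Polylog versus linear: `3 · (log₂ n + c)^c + 3 ≤ n` for all large `n`. [folklore] -/
theorem three_mul_polylog_le (c : ℕ) :
    ∃ n₀ : ℕ, ∀ n ≥ n₀, 3 * (Nat.log 2 n + c) ^ c + 3 ≤ n := by
  refine ⟨2 ^ 2 ^ (2 * (c + 2) + 3), fun n hn => ?_⟩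
  set L := Nat.log 2 n with hL
  have he1 : 1 ≤ 2 ^ (2 * (c + 2) + 3) := Nat.one_le_two_pow
  have hn0 : n ≠ 0 := by
    have : 1 ≤ 2 ^ 2 ^ (2 * (c + 2) + 3) := Nat.one_le_two_pow
    omega
  have hL0 : 2 ^ (2 * (c + 2) + 3) ≤ L := Nat.le_log_of_pow_le one_lt_two hn
  set y := L + c with hy
  have hy1 : 2 ^ (2 * (c + 2) + 3) ≤ y := le_trans hL0 (Nat.le_add_right _ _)
  have hpow : y ^ (c + 2) ≤ 2 ^ y := pow_le_two_pow (c + 2) y hy1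
  -- `6 · 2^c ≤ y`
  have h6 : 6 * 2 ^ c ≤ y := by
    calc 6 * 2 ^ c ≤ 2 ^ 3 * 2 ^ c := Nat.mul_le_mul_right _ (by norm_num)
      _ = 2 ^ (c + 3) := by rw [← pow_add, add_comm]
      _ ≤ 2 ^ (2 * (c + 2) + 3) := Nat.pow_le_pow_right two_pos (by omega)
      _ ≤ y := hy1
  have hyc : 1 ≤ y ^ c := Nat.one_le_pow _ _ (by omega)
  have key : (3 * y ^ c + 3) * 2 ^ c ≤ 2 ^ L * 2 ^ c :=
    calc (3 * y ^ c + 3) * 2 ^ c ≤ (6 * y ^ c) * 2 ^ c := Nat.mul_le_mul_right _ (by omega)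
      _ = y ^ c * (6 * 2 ^ c) := by ring
      _ ≤ y ^ c * y := Nat.mul_le_mul_left _ h6
      _ ≤ y ^ c * y * y := Nat.le_mul_of_pos_right _ (by omega)
      _ = y ^ (c + 2) := by ring
      _ ≤ 2 ^ y := hpow
      _ = 2 ^ L * 2 ^ c := by rw [hy, pow_add]
  calc 3 * (L + c) ^ c + 3 ≤ 2 ^ L := Nat.le_of_mul_le_mul_right key (Nat.two_pow_pos c)
    _ ≤ n := Nat.pow_log_le_self 2 hn0

/-- **The crux `PerDivisionHard` on the cofactors `h = per_n^M` (all `M`, uniformly).** For every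
`c`, for all large `n` and every `M`: `2^{(log₂ n + c)^c} < L₊(per_n · per_n^M) + L₊(per_n^M)`,
since `per_n · per_n^M = per_n^{M+1}` alone costs at least `2^{⌊n/3⌋} > 2^{(log₂ n + c)^c}`
(`perPow_complexity_lower`, `three_mul_polylog_le`).  Idea card
`Cruxes/PerDivisionHard/Ideas/typed-vertex-rectangles.md` (planner-cruxidea-…-5065-2): the typed,
multiplicity-insensitive form of Jerrum–Snir's bound for the permanent, which is the case `M = 0`
of the pair [cite: JerrumSnir1982, §4.3]. -/
theorem perDivisionHard_powers :
    ∀ c : ℕ, ∃ n₀ : ℕ, ∀ n ≥ n₀, ∀ M : ℕ,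
      2 ^ ((Nat.log 2 n + c) ^ c) <
        complexity (perPoly (Fin n) ℝ≥0 * perPoly (Fin n) ℝ≥0 ^ M) +
          complexity (perPoly (Fin n) ℝ≥0 ^ M) := by
  intro c
  obtain ⟨n₀, hn₀⟩ := three_mul_polylog_le c
  refine ⟨n₀, fun n hn M => ?_⟩
  have h3 := hn₀ n hn
  have hpoly : (Nat.log 2 n + c) ^ c ≠ 0 := by
    rcases Nat.eq_zero_or_pos c with rfl | hc
    · simp
    · exact pow_ne_zero _ (by omega)
  have hlt : (Nat.log 2 n + c) ^ c < n / 3 := by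
    have := (Nat.le_div_iff_mul_le (by norm_num : 0 < 3)).mpr
      (show ((Nat.log 2 n + c) ^ c + 1) * 3 ≤ n by omega)
    omega
  calc 2 ^ ((Nat.log 2 n + c) ^ c) < 2 ^ (n / 3) := Nat.pow_lt_pow_right (by norm_num) hlt
    _ ≤ complexity (perPoly (Fin n) ℝ≥0 ^ (M + 1)) :=
        perPow_complexity_lower n (M + 1) (by omega) (Nat.succ_pos M)
    _ = complexity (perPoly (Fin n) ℝ≥0 * perPoly (Fin n) ℝ≥0 ^ M) := by rw [← pow_succ']
    _ ≤ _ := Nat.le_add_right _ _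

end Summit.ValiantsHypothesis.ValiantsHypothesis.Theorems.DivisionGapPerDivisionHard

end
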